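import Literature.NumberTheory.EllipticCurves.ModularCurve
import HarnessLib

/-!
# The minimal modular degree of a Weierstrass model at level `N`

Topic `NumberTheory/EllipticCurves`, namespace `Literature.NumberTheory.EllipticCurves.ModularForms`
(next to `ModularCurve.lean`, whose hypothesis structure `ModularParametrizationData W N` — newform
`f`, Néron-type period pair `L`, uniformisation `ℂ → W(ℂ)` with kernel `Λ_L`, integer Manin
constant `c` with `c Λ_f ⊆ Λ_L`, modular degree `deg` pinned by its fibre count — is the only
input; the import closure is deliberately that of `ModularCurve.lean`, so that route files can use
the notion cheaply).

## Contents

* `minModularDegree W N = sInf {deg D | D : ModularParametrizationData W N}` — the least modular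
  degree of a parametrisation datum of the model `W/ℚ` at level `N`, with the junk value `0`
  exactly when there is no datum (`minModularDegree_eq_zero_iff`; a datum has `deg ≥ 1`). For a
  globally minimal `W` of conductor `N` this is the degree of Frey's `φ_E : X₀(N_E) → E`, "a
  `ℚ`-rational non-trivial morphism of minimal degree", for which `φ_E^* ω_E = c_φ f_E(z) dz` with
  `c_φ ∈ ℤ ∖ {0}` (Frey 1997, §3, p. 543); for the `X₀(N)`-optimal curve it is the modular degree
  `m_E` (Zagier 1985, §1; Agashe–Ribet–Stein 2012, §1). It replaces the inlined
  `sInf {d | ∃ D, D.modularDegree = d}` of the congruence-number routes (`minModularDegree_def` is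
  `rfl`, and the body is that very term, so statements written with the inlined `sInf` are
  interchangeable with the named form).
* The `sInf` API: `minModularDegree_le`, `exists_modularDegree_eq_minModularDegree` (a minimiser
  exists as soon as one datum does, `Nat.sInf_mem`), `minModularDegree_eq_zero_iff` /
  `minModularDegree_pos_iff`, `minModularDegree_eq_iff`, `le_minModularDegree_iff`,
  `modularDegree_eq_minModularDegree_iff` (the routes' "`D.deg ≤ D'.deg` for all `D'`"),
  `exists_modularDegree_le_iff` (the routes' "`∃ D, deg D ≤ B`", for any monotone function of the
  degree, e.g. the cast to `ℝ`), transport along the level (`minModularDegree_congr_level`, for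
  `N = N_W`) and along degree-non-increasing maps of data (`minModularDegree_le_of_map`,
  `minModularDegree_eq_of_maps`).
* The invariance `minModularDegree (C • W) N = minModularDegree W N` under changes of variables
  with `u = ±1` (in particular between two globally minimal models) is proved in the companion file
  `ModularDegreeMinimalSmul.lean`, which needs the substitution on points and `L(C • W) = L(W)`.

## What is NOT here

* No comparison with the modular degree of the optimal curve / Pasten's `δ_{1,N}` (a factor coming
  from a cyclic isogeny of degree `≤ 163`, Mazur 1978 and Kenku 1982, and Néron functoriality):
  that notion is not in the tree yet.
* Nothing is asserted about existence of data (that is the named fact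
  `nonempty_modularParametrizationData`, modularity); every statement here is proved, and the
  notion is meant for globally minimal `W`, where `Λ_L` is the Néron lattice and `c` the Manin
  constant of `φ`.

## References

* G. Frey, *On ternary equations of Fermat type and relations with elliptic curves*, in *Modular
  Forms and Fermat's Last Theorem* (Cornell–Silverman–Stevens, eds.), Springer 1997, 527–548: §3,
  p. 543 (PDF p. 639 of the held volume). [Frey1997Ternary]
* D. Zagier, *Modular parametrizations of elliptic curves*, Canad. Math. Bull. 28 (1985), §1.
  [ZagierCMB1985]
* A. Agashe, K. Ribet, W. Stein, *The modular degree, congruence primes, and multiplicity one*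
  (2012), §1–2. [AgasheRibetStein2012]
-/

noncomputable section

namespace Literature.NumberTheory.EllipticCurves.ModularForms

/-! ### The minimal modular degree -/

section Definition

variable (W : WeierstrassCurve ℚ) (N : ℕ) [NeZero N]

/-- The **minimal modular degree** of the Weierstrass model `W/ℚ` at level `N`: the least modular
degree `deg φ_D` of a modular parametrisation datum `D : ModularParametrizationData W N` (newform
`f ∈ S₂(Γ₀(N))` of `W`, Néron-type lattice, uniformisation, integer Manin constant `c`, degree),
and `0` if there is no such datum (`sInf ∅ = 0`; a datum has positive degree, so `0` is an honest
flag, `minModularDegree_eq_zero_iff`). For a globally minimal model of conductor `N` this is the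
degree of Frey's `φ_E : X₀(N_E) → E`, "a `ℚ`-rational non-trivial morphism of minimal degree",
with `φ_E^* ω_E = c_φ f_E(z) dz`, `c_φ ∈ ℤ ∖ {0}` (Frey 1997, §3, p. 543); for the optimal curve of
the isogeny class it is the modular degree `m_E` (Zagier 1985, §1; Agashe–Ribet–Stein 2012, §1).
[cite: Frey1997Ternary, §3, p. 543 (PDF p. 639)] -/
def minModularDegree : ℕ :=
  sInf {d : ℕ | ∃ D : ModularParametrizationData W N, D.modularDegree = d}

/-- Unfolding of `minModularDegree` (by definition; the inlined form used by the routes).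
[folklore] -/
theorem minModularDegree_def :
    minModularDegree W N =
      sInf {d : ℕ | ∃ D : ModularParametrizationData W N, D.modularDegree = d} :=
  rfl

variable {W N}

/-- Every datum bounds the minimal modular degree from above (`Nat.sInf_le`). [folklore] -/
theorem minModularDegree_le (D : ModularParametrizationData W N) :
    minModularDegree W N ≤ D.modularDegree :=
  Nat.sInf_le ⟨D, rfl⟩

/-- As soon as one datum exists, some datum realises the minimal modular degree (`Nat.sInf_mem`:
every nonempty set of naturals has a least element). [folklore] -/
theorem exists_modularDegree_eq_minModularDegree (h : Nonempty (ModularParametrizationData W N)) :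
    ∃ D : ModularParametrizationData W N, D.modularDegree = minModularDegree W N :=
  Nat.sInf_mem (s := {d : ℕ | ∃ D : ModularParametrizationData W N, D.modularDegree = d})
    (h.elim fun D ↦ ⟨D.modularDegree, D, rfl⟩)

/-- A datum of minimal degree: its degree is `minModularDegree W N` and is `≤` the degree of every
other datum. [folklore] -/
theorem exists_minimal_datum (h : Nonempty (ModularParametrizationData W N)) :
    ∃ D : ModularParametrizationData W N, D.modularDegree = minModularDegree W N ∧
      ∀ D' : ModularParametrizationData W N, D.modularDegree ≤ D'.modularDegree := by
  obtain ⟨D, hD⟩ := exists_modularDegree_eq_minModularDegree h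
  exact ⟨D, hD, fun D' ↦ hD ▸ minModularDegree_le D'⟩

/-- `minModularDegree W N = 0` exactly when `W` has no parametrisation datum at level `N` (a datum
has positive degree, `deg_pos`). [folklore] -/
theorem minModularDegree_eq_zero_iff :
    minModularDegree W N = 0 ↔ IsEmpty (ModularParametrizationData W N) := by
  rw [minModularDegree, Nat.sInf_eq_zero]
  constructor
  · rintro (⟨D, hD⟩ | h)
    · exact absurd hD D.deg_pos.ne'
    · exact ⟨fun D ↦ (Set.eq_empty_iff_forall_notMem.mp h) D.modularDegree ⟨D, rfl⟩⟩
  · intro h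
    exact Or.inr (Set.eq_empty_iff_forall_notMem.mpr fun d ⟨D, _⟩ ↦ h.elim D)

/-- With no datum the minimal modular degree is the junk value `0`. [folklore] -/
theorem minModularDegree_of_isEmpty (h : IsEmpty (ModularParametrizationData W N)) :
    minModularDegree W N = 0 :=
  minModularDegree_eq_zero_iff.mpr h

/-- `0 < minModularDegree W N` exactly when a datum exists. [folklore] -/
theorem minModularDegree_pos_iff :
    0 < minModularDegree W N ↔ Nonempty (ModularParametrizationData W N) := by
  rw [pos_iff_ne_zero, Ne, minModularDegree_eq_zero_iff, not_isEmpty_iff]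

/-- A datum makes the minimal modular degree positive. [folklore] -/
theorem minModularDegree_pos (D : ModularParametrizationData W N) : 0 < minModularDegree W N :=
  minModularDegree_pos_iff.mpr ⟨D⟩

/-- Characterisation of the minimal modular degree (when a datum exists): `m` is attained and is a
lower bound. [folklore] -/
theorem minModularDegree_eq_iff (h : Nonempty (ModularParametrizationData W N)) {m : ℕ} :
    minModularDegree W N = m ↔
      (∃ D : ModularParametrizationData W N, D.modularDegree = m) ∧
        ∀ D : ModularParametrizationData W N, m ≤ D.modularDegree := by
  constructor
  · rintro rfl
    exact ⟨exists_modularDegree_eq_minModularDegree h, minModularDegree_le⟩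
  · rintro ⟨⟨D, rfl⟩, hmin⟩
    obtain ⟨D₀, h₀⟩ := exists_modularDegree_eq_minModularDegree h
    exact le_antisymm (minModularDegree_le D) (h₀ ▸ hmin D₀)

/-- Lower bounds (when a datum exists): `m ≤ minModularDegree W N` iff `m ≤ deg D` for every
datum `D`. [folklore] -/
theorem le_minModularDegree_iff (h : Nonempty (ModularParametrizationData W N)) {m : ℕ} :
    m ≤ minModularDegree W N ↔ ∀ D : ModularParametrizationData W N, m ≤ D.modularDegree := by
  refine ⟨fun hm D ↦ hm.trans (minModularDegree_le D), fun hm ↦ ?_⟩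
  obtain ⟨D₀, h₀⟩ := exists_modularDegree_eq_minModularDegree h
  exact h₀ ▸ hm D₀

/-- A datum has degree `minModularDegree W N` iff it has minimal degree among all data — the form
"`∀ D', deg D ≤ deg D'`" in which the routes phrase minimality. [folklore] -/
theorem modularDegree_eq_minModularDegree_iff (D : ModularParametrizationData W N) :
    D.modularDegree = minModularDegree W N ↔
      ∀ D' : ModularParametrizationData W N, D.modularDegree ≤ D'.modularDegree := by
  refine ⟨fun h D' ↦ h ▸ minModularDegree_le D', fun h ↦ ?_⟩
  obtain ⟨D₀, h₀⟩ := exists_modularDegree_eq_minModularDegree ⟨D⟩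
  exact le_antisymm (h₀ ▸ h D₀) (minModularDegree_le D)

/-- "Some datum has degree `≤ B`" iff a datum exists and `minModularDegree W N ≤ B`, for any
monotone `g : ℕ → α` applied to the degree (e.g. the cast to `ℝ`) — the form "`∃ D, deg D ≤ B`"
of the degree conjectures in the routes. [folklore] -/
theorem exists_modularDegree_le_iff {α : Type*} [Preorder α] {g : ℕ → α} (hg : Monotone g)
    {B : α} :
    (∃ D : ModularParametrizationData W N, g D.modularDegree ≤ B) ↔
      Nonempty (ModularParametrizationData W N) ∧ g (minModularDegree W N) ≤ B := by
  constructor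
  · rintro ⟨D, hD⟩
    exact ⟨⟨D⟩, (hg (minModularDegree_le D)).trans hD⟩
  · rintro ⟨h, hB⟩
    obtain ⟨D, hD⟩ := exists_modularDegree_eq_minModularDegree h
    exact ⟨D, hD ▸ hB⟩

/-- The case `g = id` of `exists_modularDegree_le_iff`. [folklore] -/
theorem exists_modularDegree_le_iff' {B : ℕ} :
    (∃ D : ModularParametrizationData W N, D.modularDegree ≤ B) ↔
      Nonempty (ModularParametrizationData W N) ∧ minModularDegree W N ≤ B :=
  exists_modularDegree_le_iff monotone_id

/-- The real-valued case of `exists_modularDegree_le_iff` (the routes bound `(deg D : ℝ)`).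
[folklore] -/
theorem exists_cast_modularDegree_le_iff {B : ℝ} :
    (∃ D : ModularParametrizationData W N, (D.modularDegree : ℝ) ≤ B) ↔
      Nonempty (ModularParametrizationData W N) ∧ (minModularDegree W N : ℝ) ≤ B :=
  exists_modularDegree_le_iff Nat.mono_cast

/-- Transport along an equality of levels (the level is a dependent index; used with
`N = W.conductorNorm ℤ`). [folklore] -/
theorem minModularDegree_congr_level {N' : ℕ} [NeZero N'] (h : N = N') :
    minModularDegree W N = minModularDegree W N' := by
  subst h
  rfl

end Definition

/-! ### Transport along maps of data -/

section Maps

variable {W W' : WeierstrassCurve ℚ} {N N' : ℕ} [NeZero N] [NeZero N']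

/-- If data of `W` at level `N` exist and can be transported to data of `W'` at level `N'`
without increasing the degree, then `minModularDegree W' N' ≤ minModularDegree W N`. [folklore] -/
theorem minModularDegree_le_of_map (h : Nonempty (ModularParametrizationData W N))
    (Φ : ModularParametrizationData W N → ModularParametrizationData W' N')
    (hΦ : ∀ D, (Φ D).modularDegree ≤ D.modularDegree) :
    minModularDegree W' N' ≤ minModularDegree W N := by
  obtain ⟨D, hD⟩ := exists_modularDegree_eq_minModularDegree h
  exact (minModularDegree_le (Φ D)).trans (hD ▸ hΦ D)

/-- Degree-non-increasing transports in both directions give equal minimal modular degrees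
(including the empty case, in which both vanish). [folklore] -/
theorem minModularDegree_eq_of_maps
    (Φ : ModularParametrizationData W N → ModularParametrizationData W' N')
    (Ψ : ModularParametrizationData W' N' → ModularParametrizationData W N)
    (hΦ : ∀ D, (Φ D).modularDegree ≤ D.modularDegree)
    (hΨ : ∀ D', (Ψ D').modularDegree ≤ D'.modularDegree) :
    minModularDegree W N = minModularDegree W' N' := by
  rcases isEmpty_or_nonempty (ModularParametrizationData W N) with h | h
  · have h' : IsEmpty (ModularParametrizationData W' N') := ⟨fun D' ↦ h.elim (Ψ D')⟩
    rw [minModularDegree_of_isEmpty h, minModularDegree_of_isEmpty h']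
  · obtain ⟨D⟩ := h
    exact le_antisymm (minModularDegree_le_of_map ⟨Φ D⟩ Ψ hΨ) (minModularDegree_le_of_map ⟨D⟩ Φ hΦ)

end Maps

/-! ### Bridge to the field names -/

section Bridge

variable {W : WeierstrassCurve ℚ} {N : ℕ} [NeZero N]

/-- The routes write both `D.deg` (the structure field) and `D.modularDegree` (its API name,
`ModularCurve.lean`); they agree by definition. [folklore] -/
theorem ModularParametrizationData.deg_eq_modularDegree (D : ModularParametrizationData W N) :
    D.deg = D.modularDegree :=
  rfl

/-- `minModularDegree` with the field `deg` in place of `modularDegree` (same term up to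
unfolding `modularDegree`). [folklore] -/
theorem minModularDegree_eq_sInf_deg :
    minModularDegree W N = sInf {d : ℕ | ∃ D : ModularParametrizationData W N, D.deg = d} :=
  rfl

/-- `minModularDegree W N ≤ D.deg` (field form of `minModularDegree_le`). [folklore] -/
theorem minModularDegree_le_deg (D : ModularParametrizationData W N) : minModularDegree W N ≤ D.deg :=
  minModularDegree_le D

/-- Field form of `modularDegree_eq_minModularDegree_iff`: `D.deg` is the minimal modular degree iff
`D.deg ≤ D'.deg` for all data `D'` (the phrasing of `DefiniteXi.SmallPrimePartOfDegree`). [folklore] -/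
theorem deg_eq_minModularDegree_iff (D : ModularParametrizationData W N) :
    D.deg = minModularDegree W N ↔ ∀ D' : ModularParametrizationData W N, D.deg ≤ D'.deg :=
  modularDegree_eq_minModularDegree_iff D

end Bridge

end Literature.NumberTheory.EllipticCurves.ModularForms

end
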